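import Summits.FinalStateConjecture.FinalStateConjecture.Theorems.EIHFluxBalanceInertialRecessionStubSlavingCOERLieKernel
import Summits.FinalStateConjecture.FinalStateConjecture.Theorems.EIHFluxBalanceInertialRecessionStubSlaving3ZeroSet
import Literature.Geometry.Lorentzian.KerrAxialKillingField

/-!
# Route EIHFluxBalance — `InertialRecession` (E′), line `SketchCleanExcision`, skeleton r13,
# stub `stub_coerMomQuant` (Bs): the lab first-variation field `Var` of a painted Kerr–Schild
# summand — linearity, the Kerr–Schild stabiliser, symmetry and smoothness

Helper file for the crux `stmt-FinalStateConjecture-17403`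
(`Summit.FinalStateConjecture.FinalStateConjecture.Theses.EIHFluxBalance.InertialRecession`, E′),
registered stub `stub_coerMomQuant` (Bs) of skeleton r13. The first-variation (Lie-derivative)
field of the painted summand `z ↦ g_{M,a}(S z)(S·, S·)` (`S = Λ⁻¹`) under the infinitesimal
rest-frame Poincaré motion `z' ↦ A z' + d` is
`Var z = Dg(Sz)(A(Sz) + d)(S·,S·) + g(Sz)(AS·, S·) + g(Sz)(S·, AS·)`.
This file records the elementary facts about `Var` used by the compactness argument of (Bs):

* `coerMomQ_skew_eq_smul_axialGenerator` — an `η`-skew operator killing `e₀` and `e₃` is a multiple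
  of the axial generator `J` (`E4.axialGenerator`);
* `coerMomQ_lieDeriv_stab_eq_zero` — **the Kerr–Schild stabiliser is Killing**: for `A` skew with
  `A e₀ = 0`, `a ≠ 0 → A e₃ = 0` and `d` a time translation,
  `Dg(x)(Ax + d) + g(x)(A·,·) + g(x)(·,A·) = 0` wherever `r > 0` (stationarity
  `Kerr.fderiv_bilin_basisVector_zero`, axisymmetry `Kerr.fderiv_bilin_axialGenerator`, and for
  `a = 0` full spherical symmetry `lieDeriv_bilin_zero_spin_rotation_eq_zero`); hence
  `coerMomQ_var_stab_eq_zero`: `Var = 0` off the painted singular set;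
* `coerMomQ_var_add`, `coerMomQ_var_smul` — `Var` is linear in `(A, d)`;
* `coerMomQ_var_symm` — `Var z` is a symmetric form;
* `coerMomQ_contDiffAt_var` — `Var` is `C^∞` jointly in `(S, A, d, z)` off the painted singular set.

Elementary; no definitions, no named facts, no `sorry`.
-/

set_option linter.dupNamespace false
set_option maxSynthPendingDepth 3

noncomputable section

open Set Function Literature.Geometry.Lorentzian Literature.Geometry.Lorentzian.Schwarzschild
open scoped InnerProductSpace Topology ContDiff

namespace Summit.FinalStateConjecture.FinalStateConjecture.Theorems.SublinearIsFree.Slaving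

/-! ### `η`-skew operators -/

/-- The `η`-skewness of `R` in components:
`−(Ru)⁰w⁰ + ⟪(Ru)⃗, w⃗⟫ − u⁰(Rw)⁰ + ⟪u⃗, (Rw)⃗⟫ = 0`. [cite: ONeill1983, Ch. 9, p. 233] -/
theorem coerMomQ_minkowski_skew_components {R : E4 →L[ℝ] E4}
    (hR : ∀ u w : E4, Minkowski.bilin (R u) w + Minkowski.bilin u (R w) = 0) (u w : E4) :
    -(R u 0 * w 0) + (R u 1 * w 1 + R u 2 * w 2 + R u 3 * w 3)
      + (-(u 0 * R w 0) + (u 1 * R w 1 + u 2 * R w 2 + u 3 * R w 3)) = 0 := by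
  have h := hR u w
  simpa [Minkowski.bilin_apply, Fin.sum_univ_three] using h

/-- **An `η`-skew operator killing `e₀` and `e₃` is a multiple of the axial generator**:
`R = (R e₁)² · J`, `J v = v₁ e₂ − v₂ e₁` (the stabiliser of the Kerr axis inside `so(1,3)` is the
line spanned by `J`). [cite: ONeill1995, Ch. 2 §2.2] -/
theorem coerMomQ_skew_eq_smul_axialGenerator {R : E4 →L[ℝ] E4}
    (hR : ∀ u w : E4, Minkowski.bilin (R u) w + Minkowski.bilin u (R w) = 0)
    (h0 : R (E4.basisVector 0) = 0) (h3 : R (E4.basisVector 3) = 0) (u : E4) :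
    R u = (R (E4.basisVector 1) 2) • E4.axialGenerator u := by
  have hc := coerMomQ_minkowski_skew_components hR
  set c : ℝ := R (E4.basisVector 1) 2 with hc_def
  have h11 : R (E4.basisVector 1) 1 = 0 := by
    have h := hc (E4.basisVector 1) (E4.basisVector 1)
    simp at h; linarith
  have h10 : R (E4.basisVector 1) 0 = 0 := by
    have h := hc (E4.basisVector 1) (E4.basisVector 0)
    simp [h0] at h; linarith
  have h13 : R (E4.basisVector 1) 3 = 0 := by
    have h := hc (E4.basisVector 1) (E4.basisVector 3)
    simp [h3] at h; linarith
  have h21 : R (E4.basisVector 2) 1 = -c := by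
    have h := hc (E4.basisVector 1) (E4.basisVector 2)
    simp at h; rw [hc_def]; linarith
  have h20 : R (E4.basisVector 2) 0 = 0 := by
    have h := hc (E4.basisVector 2) (E4.basisVector 0)
    simp [h0] at h; linarith
  have h22 : R (E4.basisVector 2) 2 = 0 := by
    have h := hc (E4.basisVector 2) (E4.basisVector 2)
    simp at h; linarith
  have h23 : R (E4.basisVector 2) 3 = 0 := by
    have h := hc (E4.basisVector 2) (E4.basisVector 3)
    simp [h3] at h; linarith
  have he1 : R (E4.basisVector 1) = c • E4.basisVector 2 := by
    ext i; fin_cases i <;> simp [h10, h11, h13, hc_def]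
  have he2 : R (E4.basisVector 2) = (-c) • E4.basisVector 1 := by
    ext i; fin_cases i <;> simp [h20, h21, h22, h23]
  have hu : u = u 0 • E4.basisVector 0 + u 1 • E4.basisVector 1 + u 2 • E4.basisVector 2
      + u 3 • E4.basisVector 3 := by
    ext i; fin_cases i <;> simp
  conv_lhs => rw [hu]
  simp only [map_add, map_smul, h0, h3, he1, he2, smul_zero, zero_add, add_zero]
  rw [E4.axialGenerator_apply]
  ext i; fin_cases i <;> simp <;> ring

/-- An `η`-skew operator killing `e₀` has spatial values: `(Ru)⁰ = η(u, Re₀) = 0`. [folklore] -/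
theorem coerMomQ_skew_apply_zero {R : E4 →L[ℝ] E4}
    (hR : ∀ u w : E4, Minkowski.bilin (R u) w + Minkowski.bilin u (R w) = 0)
    (h0 : R (E4.basisVector 0) = 0) (u : E4) : R u 0 = 0 := by
  have h := coerMomQ_minkowski_skew_components hR u (E4.basisVector 0)
  simp [h0] at h
  linarith

/-- An `η`-skew operator killing `e₀` is spatially skew: `⟪(Ru)⃗, w⃗⟫ = −⟪u⃗, (Rw)⃗⟫`. [folklore] -/
theorem coerMomQ_skew_sdot {R : E4 →L[ℝ] E4}
    (hR : ∀ u w : E4, Minkowski.bilin (R u) w + Minkowski.bilin u (R w) = 0)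
    (h0 : R (E4.basisVector 0) = 0) (u w : E4) : sdot (R u) w = -sdot u (R w) := by
  have h := coerMomQ_minkowski_skew_components hR u w
  rw [coerMomQ_skew_apply_zero hR h0 u, coerMomQ_skew_apply_zero hR h0 w] at h
  simp only [sdot, PiLp.inner_apply, E4.spatial_apply, RCLike.inner_apply, conj_trivial,
    Fin.sum_univ_three, Fin.succ_zero_eq_one, Fin.succ_one_eq_two]
  have e3 : (2 : Fin 3).succ = (3 : Fin 4) := rfl
  simp only [e3]
  linarith

/-! ### The Kerr–Schild stabiliser is Killing -/

/-- A vector with vanishing spatial part is a time translation: `d = d⁰ e₀`. [folklore] -/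
theorem coerMomQ_eq_smul_basisVector_zero_of_spatial_eq_zero {d : E4} (hd : E4.spatial d = 0) :
    d = (d 0) • E4.basisVector 0 := by
  have hc : ∀ i : Fin 3, d i.succ = 0 := fun i ↦ by
    have h := congrArg (fun y : E3 ↦ y i) hd
    simpa using h
  ext i
  fin_cases i
  · simp
  · simpa using hc 0
  · simpa using hc 1
  · exact (by simpa using hc 2 : d 3 = 0).trans (by simp)

/-- **The Kerr–Schild stabiliser is Killing.** For an `η`-skew `A` with `A e₀ = 0` and
`a ≠ 0 → A e₃ = 0` (an axial rotation rate; for `a = 0` any spatial rotation rate) and a time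
translation `d` (`d⃗ = 0`), the first variation of the Kerr–Schild components under the
infinitesimal Poincaré motion `x ↦ Ax + d` vanishes wherever `r > 0`:
`Dg(x)(Ax + d)(v,w) + g(x)(Av, w) + g(x)(v, Aw) = 0` — stationarity (`∂_{t*} g = 0`), axisymmetry
(`𝓛_{∂_φ} g = 0`) and, for Schwarzschild, spherical symmetry. [cite: ONeill1995, Ch. 2 §2.2] -/
theorem coerMomQ_lieDeriv_stab_eq_zero (M a : ℝ) {x : E4} (hx : 0 < Kerr.radius a x)
    {A : E4 →L[ℝ] E4} (hA : ∀ u w : E4, Minkowski.bilin (A u) w + Minkowski.bilin u (A w) = 0)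
    (h0 : A (E4.basisVector 0) = 0) (h3 : a ≠ 0 → A (E4.basisVector 3) = 0)
    {d : E4} (hd : E4.spatial d = 0) (v w : E4) :
    fderiv ℝ (Kerr.bilin M a) x (A x + d) v w + Kerr.bilin M a x (A v) w
      + Kerr.bilin M a x v (A w) = 0 := by
  have hdiff : DifferentiableAt ℝ (Kerr.bilin M a) x :=
    (Kerr.contDiffAt_bilin M a hx (n := 1)).differentiableAt one_ne_zero
  rw [coerMomQ_eq_smul_basisVector_zero_of_spatial_eq_zero hd, map_add, map_smul,
    Kerr.fderiv_bilin_basisVector_zero M a hdiff, smul_zero, add_zero]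
  by_cases ha : a = 0
  · subst ha
    have hxs : E4.spatial x ≠ 0 := by
      rw [Kerr.radius_zero_left, E4.spatialNorm] at hx
      exact norm_pos_iff.mp hx
    exact lieDeriv_bilin_zero_spin_rotation_eq_zero M hxs (R := A)
      (coerMomQ_skew_apply_zero hA h0) (coerMomQ_skew_sdot hA h0) v w
  · have hJ := coerMomQ_skew_eq_smul_axialGenerator hA h0 (h3 ha)
    set c : ℝ := A (E4.basisVector 1) 2
    rw [hJ x, hJ v, hJ w, map_smul, map_smul, map_smul]
    simp only [FunLike.coe_smul, Pi.smul_apply, smul_eq_mul]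
    have h := Kerr.fderiv_bilin_axialGenerator M a hdiff v w
    linear_combination c * h

/-! ### The lab first-variation field `Var` -/

/-- **`Var` vanishes on the Kerr–Schild stabiliser** (off the painted singular set): for `A` skew
with `A e₀ = 0`, `a ≠ 0 → A e₃ = 0` and `d⃗ = 0`, the lab first-variation field
`Dg(Sz)(A(Sz) + d)(S·,S·) + g(Sz)(AS·,S·) + g(Sz)(S·,AS·)` is zero wherever `r(Sz) > 0`.
[cite: ONeill1995, Ch. 2 §2.2] -/
theorem coerMomQ_var_stab_eq_zero (M a : ℝ) (S : E4 →L[ℝ] E4)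
    {A : E4 →L[ℝ] E4} (hA : ∀ u w : E4, Minkowski.bilin (A u) w + Minkowski.bilin u (A w) = 0)
    (h0 : A (E4.basisVector 0) = 0) (h3 : a ≠ 0 → A (E4.basisVector 3) = 0)
    {d : E4} (hd : E4.spatial d = 0) {z : E4} (hz : 0 < Kerr.radius a (S z)) :
    (fderiv ℝ (Kerr.bilin M a) (S z) (A (S z) + d)).bilinearComp S S
      + (Kerr.bilin M a (S z)).bilinearComp (A.comp S) S
      + (Kerr.bilin M a (S z)).bilinearComp S (A.comp S) = 0 := by
  ext v w
  simp only [_root_.add_apply, ContinuousLinearMap.bilinearComp_apply,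
    ContinuousLinearMap.coe_comp, comp_apply, _root_.zero_apply]
  exact coerMomQ_lieDeriv_stab_eq_zero M a hz hA h0 h3 hd (S v) (S w)

/-- **`Var` is additive in `(A, d)`.** [folklore] -/
theorem coerMomQ_var_add (M a : ℝ) (S A₁ A₂ : E4 →L[ℝ] E4) (d₁ d₂ z : E4) :
    (fderiv ℝ (Kerr.bilin M a) (S z) ((A₁ + A₂) (S z) + (d₁ + d₂))).bilinearComp S S
      + (Kerr.bilin M a (S z)).bilinearComp ((A₁ + A₂).comp S) S
      + (Kerr.bilin M a (S z)).bilinearComp S ((A₁ + A₂).comp S)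
    = ((fderiv ℝ (Kerr.bilin M a) (S z) (A₁ (S z) + d₁)).bilinearComp S S
        + (Kerr.bilin M a (S z)).bilinearComp (A₁.comp S) S
        + (Kerr.bilin M a (S z)).bilinearComp S (A₁.comp S))
      + ((fderiv ℝ (Kerr.bilin M a) (S z) (A₂ (S z) + d₂)).bilinearComp S S
        + (Kerr.bilin M a (S z)).bilinearComp (A₂.comp S) S
        + (Kerr.bilin M a (S z)).bilinearComp S (A₂.comp S)) := by
  ext v w
  simp only [_root_.add_apply, ContinuousLinearMap.bilinearComp_apply,
    ContinuousLinearMap.coe_comp, comp_apply, map_add]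
  ring

/-- **`Var` is homogeneous in `(A, d)`.** [folklore] -/
theorem coerMomQ_var_smul (M a : ℝ) (S A : E4 →L[ℝ] E4) (d z : E4) (c : ℝ) :
    (fderiv ℝ (Kerr.bilin M a) (S z) ((c • A) (S z) + c • d)).bilinearComp S S
      + (Kerr.bilin M a (S z)).bilinearComp ((c • A).comp S) S
      + (Kerr.bilin M a (S z)).bilinearComp S ((c • A).comp S)
    = c • ((fderiv ℝ (Kerr.bilin M a) (S z) (A (S z) + d)).bilinearComp S S
        + (Kerr.bilin M a (S z)).bilinearComp (A.comp S) S
        + (Kerr.bilin M a (S z)).bilinearComp S (A.comp S)) := by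
  ext v w
  simp only [_root_.add_apply, ContinuousLinearMap.bilinearComp_apply,
    ContinuousLinearMap.coe_comp, comp_apply, FunLike.coe_smul, Pi.smul_apply,
    map_smul, smul_eq_mul]
  have h : c • A (S z) + c • d = c • (A (S z) + d) := (smul_add c _ _).symm
  rw [h, map_smul, FunLike.coe_smul, Pi.smul_apply, FunLike.coe_smul,
    Pi.smul_apply, smul_eq_mul]
  ring

/-- **`Var z` is a symmetric form** (off the painted singular set): `g` and `Dg(·)(u)` are
symmetric. [folklore] -/
theorem coerMomQ_var_symm (M a : ℝ) (S A : E4 →L[ℝ] E4) (d : E4) {z : E4}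
    (hz : 0 < Kerr.radius a (S z)) (v w : E4) :
    ((fderiv ℝ (Kerr.bilin M a) (S z) (A (S z) + d)).bilinearComp S S
        + (Kerr.bilin M a (S z)).bilinearComp (A.comp S) S
        + (Kerr.bilin M a (S z)).bilinearComp S (A.comp S)) v w
    = ((fderiv ℝ (Kerr.bilin M a) (S z) (A (S z) + d)).bilinearComp S S
        + (Kerr.bilin M a (S z)).bilinearComp (A.comp S) S
        + (Kerr.bilin M a (S z)).bilinearComp S (A.comp S)) w v := by
  have hdiff : DifferentiableAt ℝ (Kerr.bilin M a) (S z) :=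
    (Kerr.contDiffAt_bilin M a hz (n := 1)).differentiableAt one_ne_zero
  simp only [_root_.add_apply, ContinuousLinearMap.bilinearComp_apply,
    ContinuousLinearMap.coe_comp, comp_apply]
  rw [Kerr.fderiv_bilin_symm M a hdiff _ (S v) (S w), Kerr.bilin_symm M a (S z) (A (S v)) (S w),
    Kerr.bilin_symm M a (S z) (S v) (A (S w))]
  ring

/-! ### Smoothness of `Var` in all its arguments -/

/-- `T(P·, Q·) = (compL.flip Q) ∘ (T ∘ P)` (bookkeeping identity for `bilinearComp`). [folklore] -/
theorem coerMomQ_bilinearComp_eq_comp (T : E4 →L[ℝ] E4 →L[ℝ] ℝ) (P Q : E4 →L[ℝ] E4) :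
    T.bilinearComp P Q = ((ContinuousLinearMap.compL ℝ E4 E4 ℝ).flip Q).comp (T.comp P) := by
  ext v w
  simp

/-- `y ↦ T(y)(P(y)·, Q(y)·)` is `Cⁿ` at a point along `Cⁿ` maps `T`, `P`, `Q`. [folklore] -/
theorem coerMomQ_contDiffAt_bilinearComp {X : Type*} [NormedAddCommGroup X] [NormedSpace ℝ X]
    {n : WithTop ℕ∞} {T : X → E4 →L[ℝ] E4 →L[ℝ] ℝ} {P Q : X → E4 →L[ℝ] E4} {x : X}
    (hT : ContDiffAt ℝ n T x) (hP : ContDiffAt ℝ n P x) (hQ : ContDiffAt ℝ n Q x) :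
    ContDiffAt ℝ n (fun y ↦ (T y).bilinearComp (P y) (Q y)) x := by
  have h1 : ContDiffAt ℝ n (fun y ↦ (T y).comp (P y)) x := hT.clm_comp hP
  have h2 := ContDiffAt.continuousLinearMap_comp (G := (E4 →L[ℝ] ℝ) →L[ℝ] (E4 →L[ℝ] ℝ))
    ((ContinuousLinearMap.compL ℝ E4 E4 ℝ).flip) hQ
  have h3 := h2.clm_comp h1
  have hfun : (fun y ↦ (T y).bilinearComp (P y) (Q y)) =
      fun y ↦ ((ContinuousLinearMap.compL ℝ E4 E4 ℝ).flip (Q y)).comp ((T y).comp (P y)) :=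
    funext fun y ↦ coerMomQ_bilinearComp_eq_comp (T y) (P y) (Q y)
  rw [hfun]
  exact h3

/-- **`Var` is `C^∞` jointly in `(S, A, d, z)`** at every point with `r(Sz) > 0` (composition of
the smooth Kerr–Schild components `Kerr.contDiffAt_bilin`, their smooth derivative, and
polynomial operations). [folklore] -/
theorem coerMomQ_contDiffAt_var (M a : ℝ)
    {q₀ : (E4 →L[ℝ] E4) × (E4 →L[ℝ] E4) × E4 × E4} (hq₀ : 0 < Kerr.radius a (q₀.1 q₀.2.2.2)) :
    ContDiffAt ℝ ∞ (fun q : (E4 →L[ℝ] E4) × (E4 →L[ℝ] E4) × E4 × E4 ↦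
      (fderiv ℝ (Kerr.bilin M a) (q.1 q.2.2.2) (q.2.1 (q.1 q.2.2.2) + q.2.2.1)).bilinearComp q.1 q.1
        + (Kerr.bilin M a (q.1 q.2.2.2)).bilinearComp (q.2.1.comp q.1) q.1
        + (Kerr.bilin M a (q.1 q.2.2.2)).bilinearComp q.1 (q.2.1.comp q.1)) q₀ := by
  -- the building blocks
  have hS : ContDiffAt ℝ ∞ (fun q : (E4 →L[ℝ] E4) × (E4 →L[ℝ] E4) × E4 × E4 ↦ q.1) q₀ :=
    contDiffAt_fst
  have hA : ContDiffAt ℝ ∞ (fun q : (E4 →L[ℝ] E4) × (E4 →L[ℝ] E4) × E4 × E4 ↦ q.2.1) q₀ :=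
    contDiffAt_fst.comp q₀ contDiffAt_snd
  have hd : ContDiffAt ℝ ∞ (fun q : (E4 →L[ℝ] E4) × (E4 →L[ℝ] E4) × E4 × E4 ↦ q.2.2.1) q₀ :=
    contDiffAt_fst.comp q₀ (contDiffAt_snd.comp q₀ contDiffAt_snd)
  have hz : ContDiffAt ℝ ∞ (fun q : (E4 →L[ℝ] E4) × (E4 →L[ℝ] E4) × E4 × E4 ↦ q.2.2.2) q₀ :=
    contDiffAt_snd.comp q₀ (contDiffAt_snd.comp q₀ contDiffAt_snd)
  have hSz : ContDiffAt ℝ ∞ (fun q : (E4 →L[ℝ] E4) × (E4 →L[ℝ] E4) × E4 × E4 ↦ q.1 q.2.2.2) q₀ :=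
    hS.clm_apply hz
  -- the Kerr–Schild components and their derivative at `S z`
  have hmem : q₀.1 q₀.2.2.2 ∈ (Kerr.region a 0 : Set E4) := by
    rw [SetLike.mem_coe, Kerr.mem_region, max_self]; exact hq₀
  have hK : ContDiffAt ℝ ∞ (fun q : (E4 →L[ℝ] E4) × (E4 →L[ℝ] E4) × E4 × E4 ↦
      Kerr.bilin M a (q.1 q.2.2.2)) q₀ :=
    ContDiffAt.comp (g := Kerr.bilin M a)
      (f := fun q : (E4 →L[ℝ] E4) × (E4 →L[ℝ] E4) × E4 × E4 ↦ q.1 q.2.2.2) q₀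
      (Kerr.contDiffAt_bilin M a hq₀) hSz
  have hDK : ContDiffAt ℝ ∞ (fun q : (E4 →L[ℝ] E4) × (E4 →L[ℝ] E4) × E4 × E4 ↦
      fderiv ℝ (Kerr.bilin M a) (q.1 q.2.2.2)) q₀ :=
    ContDiffAt.comp (g := fderiv ℝ (Kerr.bilin M a))
      (f := fun q : (E4 →L[ℝ] E4) × (E4 →L[ℝ] E4) × E4 × E4 ↦ q.1 q.2.2.2) q₀
      (((isMetricOn_kerr_bilin M a).contDiffAt_fderiv hmem)) hSz
  have hdir : ContDiffAt ℝ ∞ (fun q : (E4 →L[ℝ] E4) × (E4 →L[ℝ] E4) × E4 × E4 ↦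
      q.2.1 (q.1 q.2.2.2) + q.2.2.1) q₀ := (hA.clm_apply hSz).add hd
  have hAS : ContDiffAt ℝ ∞ (fun q : (E4 →L[ℝ] E4) × (E4 →L[ℝ] E4) × E4 × E4 ↦ q.2.1.comp q.1) q₀ :=
    hA.clm_comp hS
  exact ((coerMomQ_contDiffAt_bilinearComp (hDK.clm_apply hdir) hS hS).add
    (coerMomQ_contDiffAt_bilinearComp hK hAS hS)).add (coerMomQ_contDiffAt_bilinearComp hK hS hAS)

/-- **`Var` is `C^∞` in the lab point** on the open set `{z | r(Sz) > 0}`, for fixed `(S, A, d)`.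
[folklore] -/
theorem coerMomQ_contDiffOn_var (M a : ℝ) (S A : E4 →L[ℝ] E4) (d : E4) :
    IsOpen {z : E4 | 0 < Kerr.radius a (S z)} ∧
    ContDiffOn ℝ ∞ (fun z : E4 ↦
      (fderiv ℝ (Kerr.bilin M a) (S z) (A (S z) + d)).bilinearComp S S
        + (Kerr.bilin M a (S z)).bilinearComp (A.comp S) S
        + (Kerr.bilin M a (S z)).bilinearComp S (A.comp S)) {z : E4 | 0 < Kerr.radius a (S z)} := by
  refine ⟨isOpen_lt continuous_const ((Kerr.continuous_radius a).comp S.continuous), ?_⟩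
  intro z hz
  have h := coerMomQ_contDiffAt_var M a (q₀ := (S, A, d, z)) hz
  have hι : ContDiffAt ℝ ∞ (fun w : E4 ↦ ((S, A, d, w) : (E4 →L[ℝ] E4) × (E4 →L[ℝ] E4) × E4 × E4)) z :=
    contDiffAt_const.prodMk (contDiffAt_const.prodMk (contDiffAt_const.prodMk contDiffAt_id))
  exact (h.comp z hι).contDiffWithinAt

/-- **Registered one-line carrier form** (`coerMomQ_var_stab_bs`) of `coerMomQ_var_stab_eq_zero`:
the lab first-variation field vanishes on the Kerr–Schild stabiliser. [cite: ONeill1995, Ch. 2 §2.2] -/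
theorem coerMomQ_var_stab_bs : open Literature.Geometry.Lorentzian in ∀ (M a : ℝ) (S : E4 →L[ℝ] E4) (A : E4 →L[ℝ] E4) (d z : E4), (∀ u w : E4, Minkowski.bilin (A u) w + Minkowski.bilin u (A w) = 0) → A (E4.basisVector 0) = 0 → (a ≠ 0 → A (E4.basisVector 3) = 0) → E4.spatial d = 0 → 0 < Kerr.radius a (S z) → (fderiv ℝ (Kerr.bilin M a) (S z) (A (S z) + d)).bilinearComp S S + (Kerr.bilin M a (S z)).bilinearComp (A.comp S) S + (Kerr.bilin M a (S z)).bilinearComp S (A.comp S) = 0 :=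
  fun M a S _ _ _ hA h0 h3 hd hz ↦ coerMomQ_var_stab_eq_zero M a S hA h0 h3 hd hz

end Summit.FinalStateConjecture.FinalStateConjecture.Theorems.SublinearIsFree.Slaving

end
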